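import Summits.QuantumFields.QCD.Theorems.CoerciveSea.Negative.CellDeterminants
import Literature.MathematicalPhysics.QuantumFieldTheory.SpectralDefectDensity

/-!
# Crux `CoerciveSea` (stmt-QuantumFields-13901), negative side — deterministic cell facts:
# a crossing is a `|μ − μ'|`-pseudomode of the CELL at every mass; a negative cell is bracketed by
# crossings above AND below

Support file of the standing disprover (refuter-cdisprove-stmt-QuantumFields-13901-g2-0, cycle 2),
companion of `CellDeterminants.lean`. Proved here (sorry-free, standard axioms):

* `wilsonCell_mass_shift` — the bare mass is a scalar shift of every Dirichlet cell,
  `D_c(μ) = D_c(μ') + (μ − μ')·1` (`wilsonDirac_mass_eq_add_scalar` compressed to the box);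
* `exists_pseudomode_of_det_eq_zero` — a kernel vector at `μ'` is an exact eigenvector of `D_c(μ)`
  with eigenvalue `μ − μ'`; `cell_nearSingular_of_crossing` — so the CELL near-kernel event
  `{∃ w ≠ 0, ‖D_c(μ) w‖² < τ²‖w‖²}` holds at every mass within `τ` of a crossing (the lower-bound
  direction for a cell Wegner law; NO analogue for the separator event of clause (i), whose Schur
  complement moves with the mass at speed `‖1 + D_ΣI D_II⁻² D_IΣ‖`);
* `crossing_above_and_below_of_neg` — a cell with negative determinant at `μ` has a crossing in
  `(μ, 0]` (the route's `SignDefectForcesCrossing` direction) AND one in `[−8, μ)`: the determinant is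
  a real polynomial in the mass, `≥ 0` at `0` and `−8` (`cellDetRe_pos` off the hopping band +
  continuity).
-/

noncomputable section

namespace Summit.QuantumFields.QCD.Theorems.CoerciveSeaNegative

open MeasureTheory Filter Matrix
open Literature.MathematicalPhysics.QuantumLattice Literature.MathematicalPhysics.QuantumFieldTheory
  Literature.Probability.LatticeModels

/-- The bare mass enters every Dirichlet cell as a scalar shift:
`D_c(μ) = D_c(μ') + (μ − μ')·1` (`wilsonDirac_mass_eq_add_scalar` compressed to the box). [folklore] -/
theorem wilsonCell_mass_shift {Nt : ℕ} [NeZero Nt]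
    (U : GaugeConfig 4 Nt (Matrix.specialUnitaryGroup (Fin 3) ℂ)) (μ μ' : ℝ) (x : TorusSite 4 Nt)
    (s : Fin 4 → ℕ) :
    wilsonCell U μ x s = wilsonCell U μ' x s + ((μ - μ' : ℝ) : ℂ) • (1 : Matrix _ _ ℂ) := by
  ext p q
  simp only [wilsonCell, toSquareBlockProp_def, Matrix.of_apply, Matrix.add_apply,
    Matrix.smul_apply, Matrix.one_apply, smul_eq_mul]
  rw [wilsonDirac_mass_eq_add_scalar _ U μ 1, wilsonDirac_mass_eq_add_scalar _ U μ' 1]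
  simp only [Matrix.add_apply, Matrix.scalar_apply]
  by_cases hpq : p = q
  · subst hpq
    simp only [Matrix.diagonal_apply_eq, if_true]
    push_cast
    ring
  · have hpq' : (p : TorusSite 4 Nt × Fin 3 × Fin 4) ≠ q := fun h => hpq (Subtype.ext h)
    simp only [Matrix.diagonal_apply_ne _ hpq', if_neg hpq]
    ring

/-- **A crossing at `μ'` is an exact `|μ − μ'|`-pseudomode of the cell at every mass `μ`**: a kernel
vector `w` of `D_c(μ')` satisfies `D_c(μ) w = (μ − μ')·w`. [folklore] -/
theorem exists_pseudomode_of_det_eq_zero {Nt : ℕ} [NeZero Nt]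
    {U : GaugeConfig 4 Nt (Matrix.specialUnitaryGroup (Fin 3) ℂ)} {μ' : ℝ} {x : TorusSite 4 Nt}
    {s : Fin 4 → ℕ} (h : (wilsonCell U μ' x s).det = 0) (μ : ℝ) :
    ∃ w : {p // wilsonBox x s p} → ℂ, w ≠ 0 ∧
      wilsonCell U μ x s *ᵥ w = ((μ - μ' : ℝ) : ℂ) • w := by
  obtain ⟨w, hw, hDw⟩ := Matrix.exists_mulVec_eq_zero_iff.mpr h
  refine ⟨w, hw, ?_⟩
  rw [wilsonCell_mass_shift U μ μ' x s, Matrix.add_mulVec, hDw, zero_add, Matrix.smul_mulVec,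
    Matrix.one_mulVec]

/-- … hence the CELL near-kernel event `{∃ w ≠ 0, ‖D_c(μ) w‖² < τ² ‖w‖²}` holds at every mass `μ`
with `|μ − μ'| < τ`: every crossing within `τ` of the valence mass makes the cell `τ`-near-singular
there (the lower-bound direction for a CELL Wegner law: its probability at level `τ = t/s` is at
least that of a crossing in the mass window `(mq − t/s, mq + t/s)`). For the SEPARATOR event of
clause (i) no such implication holds: `S_Σ(μ) = D_ΣΣ(μ) − D_ΣI D_II(μ)⁻¹ D_IΣ` moves with the mass at
speed `‖1 + D_ΣI D_II⁻² D_IΣ‖`, typically `≍ s^{3/2}–s²` in a box of side `s` (Part D'). [folklore] -/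
theorem cell_nearSingular_of_crossing {Nt : ℕ} [NeZero Nt]
    {U : GaugeConfig 4 Nt (Matrix.specialUnitaryGroup (Fin 3) ℂ)} {μ' : ℝ} {x : TorusSite 4 Nt}
    {s : Fin 4 → ℕ} (h : (wilsonCell U μ' x s).det = 0) {μ τ : ℝ} (hτ : |μ - μ'| < τ) :
    ∃ w : {p // wilsonBox x s p} → ℂ, w ≠ 0 ∧
      ∑ p, ‖(wilsonCell U μ x s *ᵥ w) p‖ ^ 2 < τ ^ 2 * ∑ p, ‖w p‖ ^ 2 := by
  obtain ⟨w, hw, hDw⟩ := exists_pseudomode_of_det_eq_zero h μ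
  refine ⟨w, hw, ?_⟩
  have hn : 0 < ∑ p, ‖w p‖ ^ 2 := by
    obtain ⟨p, hp⟩ : ∃ p, w p ≠ 0 := by
      by_contra hall; push Not at hall; exact hw (funext hall)
    exact Finset.sum_pos' (fun q _ => by positivity) ⟨p, Finset.mem_univ _, by positivity⟩
  have heq : ∑ p, ‖(wilsonCell U μ x s *ᵥ w) p‖ ^ 2 = (μ - μ') ^ 2 * ∑ p, ‖w p‖ ^ 2 := by
    rw [hDw, Finset.mul_sum]
    refine Finset.sum_congr rfl fun p _ => ?_
    rw [Pi.smul_apply, smul_eq_mul, norm_mul, Complex.norm_real, Real.norm_eq_abs, mul_pow, sq_abs]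
  rw [heq]
  have h2 : (μ - μ') ^ 2 < τ ^ 2 := by
    have := abs_nonneg (μ - μ')
    calc (μ - μ') ^ 2 = |μ - μ'| ^ 2 := (sq_abs _).symm
      _ < τ ^ 2 := by gcongr
  exact mul_lt_mul_of_pos_right h2 hn

/-- **Two-sided bracketing of a negative cell**: if a Dirichlet cell is negative at `μ` then it has a
crossing in `(μ, 0]` (route item `SignDefectForcesCrossing`, the crossing ABOVE) AND one in
`[−8, μ)` (the crossing BELOW): the determinant is a real polynomial in the mass, `≥ 0` at `0` and at
`−8` by positivity off the hopping band (Part B) and continuity. The lower crossing is a real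
eigenvalue `> |μ|` of the massless cell operator (a doubler-side or deeper physical real mode); sign
bookkeeping that counts only crossings above the valence mass is complete only modulo this pairing.
[folklore] -/
theorem crossing_above_and_below_of_neg {Nt : ℕ} [NeZero Nt]
    (U : GaugeConfig 4 Nt (Matrix.specialUnitaryGroup (Fin 3) ℂ)) {μ : ℝ} (x : TorusSite 4 Nt)
    (s : Fin 4 → ℕ) (hneg : cellDetRe U μ x s < 0) :
    (∃ μ₁ ∈ Set.Ioc μ 0, (wilsonCell U μ₁ x s).det = 0) ∧
      (∃ μ₂ ∈ Set.Ico (-8 : ℝ) μ, (wilsonCell U μ₂ x s).det = 0) := by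
  -- the real polynomial f(ν) = Re det D_c(ν): continuous, ≥ 0 off the open band (−8, 0)
  set f : ℝ → ℝ := fun ν => cellDetRe U ν x s with hf
  have hcont : Continuous f := by
    have h1 : Continuous fun ν : ℝ => wilsonCell U ν x s := by
      have : (fun ν : ℝ => wilsonCell U ν x s) =
          fun ν : ℝ => wilsonCell U 0 x s + ((ν - 0 : ℝ) : ℂ) • (1 : Matrix _ _ ℂ) :=
        funext fun ν => wilsonCell_mass_shift U ν 0 x s
      rw [this]
      exact continuous_const.add ((Complex.continuous_ofReal.comp (continuous_id.sub
        continuous_const)).smul continuous_const)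
    exact Complex.continuous_re.comp h1.matrix_det
  have hreal : ∀ ν, ((wilsonCell U ν x s).det : ℂ) = ((f ν : ℝ) : ℂ) := fun ν =>
    Complex.ext (by simp [hf, cellDetRe_eq]) (by simpa using det_wilsonCell_im U ν x s)
  have hzero : ∀ ν, f ν = 0 → (wilsonCell U ν x s).det = 0 := fun ν hν => by
    rw [hreal ν, hν]; simp
  have hpos : ∀ ν : ℝ, (0 < ν ∨ ν < -8) → 0 < f ν := by
    intro ν hν
    have h4 : 4 < |ν + 4| := by
      rcases hν with h | h
      · rw [abs_of_pos (by linarith)]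
        linarith
      · rw [abs_of_neg (by linarith)]
        linarith
    exact cellDetRe_pos U h4 x s
  have hnonneg : ∀ ν : ℝ, (0 ≤ ν ∨ ν ≤ -8) → 0 ≤ f ν := by
    intro ν hν
    rcases hν with hν | hν
    · rcases hν.lt_or_eq with hlt | heq
      · exact (hpos ν (Or.inl hlt)).le
      · subst heq
        have ht : Tendsto f (nhdsWithin 0 (Set.Ioi 0)) (nhds (f 0)) :=
          (hcont.tendsto 0).mono_left nhdsWithin_le_nhds
        exact ge_of_tendsto ht
          (eventually_nhdsWithin_of_forall fun ν hν => (hpos ν (Or.inl hν)).le)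
    · rcases hν.lt_or_eq with hlt | heq
      · exact (hpos ν (Or.inr hlt)).le
      · subst heq
        have ht : Tendsto f (nhdsWithin (-8) (Set.Iio (-8))) (nhds (f (-8))) :=
          (hcont.tendsto (-8)).mono_left nhdsWithin_le_nhds
        exact ge_of_tendsto ht
          (eventually_nhdsWithin_of_forall fun ν hν => (hpos ν (Or.inr hν)).le)
  have hμ0 : μ < 0 := by
    by_contra hge; push Not at hge; exact absurd (hnonneg μ (Or.inl hge)) (not_le.mpr hneg)
  have hμ8 : -8 < μ := by
    by_contra hle; push Not at hle; exact absurd (hnonneg μ (Or.inr hle)) (not_le.mpr hneg)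
  constructor
  · -- IVT on [μ, 0]
    have hmem : (0 : ℝ) ∈ Set.Icc (f μ) (f 0) := ⟨hneg.le, hnonneg 0 (Or.inl le_rfl)⟩
    obtain ⟨ν, hν, hν0⟩ := intermediate_value_Icc hμ0.le hcont.continuousOn hmem
    refine ⟨ν, ⟨lt_of_le_of_ne hν.1 ?_, hν.2⟩, hzero ν hν0⟩
    rintro rfl; exact absurd hν0 hneg.ne
  · -- IVT on [−8, μ]
    have hmem : (0 : ℝ) ∈ Set.Icc (f μ) (f (-8)) := ⟨hneg.le, hnonneg (-8) (Or.inr le_rfl)⟩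
    obtain ⟨ν, hν, hν0⟩ := intermediate_value_Icc' hμ8.le hcont.continuousOn hmem
    refine ⟨ν, ⟨hν.1, lt_of_le_of_ne hν.2 ?_⟩, hzero ν hν0⟩
    rintro rfl; exact absurd hν0 hneg.ne



end Summit.QuantumFields.QCD.Theorems.CoerciveSeaNegative

end
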